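import Mathlib
import Summits.Ventures.HodgeRepro2.T6N42RichHost
import Summits.Ventures.HodgeRepro2.T6N2ToyJoint3

/-!
# T6N42RichHostToy3 — THE HOST-FORM N4.2 BLOCK ON THE v3 TOY CARRIER (§10.5(ii)(c)/(d) at the
composition level): `N42_side_host₃` / `N42_sideB_host₃` instantiated on `N2ToyJoint3.toy₃`, jointly with
the seven binders of `periodInputN_of_mains₃` (owner t6-p5; imports T6N42RichHost — no d3 input)

`T6N42RichHost.lean` states the N4.2 block of a composition on the lead's carrier `NAut3` from the host
objects alone: `N42Rich.N42_side_host₃ M F hF S hS hM hGI : M.sA.d42.ThetaNonzeroEverywhere` for a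
first-lift side `F` (under its laws `hF`) and host readings `S` of `M.sA.d42` (under theirs `hS`), plus
the two displays. This file is the kernel witness that those binders instantiate on the v3 TOY CARRIER
`N2ToyJoint3.toy₃ F hw hw0 : NAut3 F (toyNDatumN F hw hw0)` (`T6N2ToyJoint3.lean`, in the tree): both
sides of the toy carrier carry the toy finite-places datum (`toy₃_sA_d42` / `toy₃_sB_d42`, by `rfl`
through `NAut3.ofNAut2` / `NAut2.ofNAut` / `NAutToyN.toy` / `NAutToy.toyNSide`), so the toy first-lift
side `toyFirstLiftSide` and the toy host readings `toyHostReadings` of `T6N42FlathLiftHost.lean` /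
`T6N42RichHost.lean` ARE a first-lift side and host readings of `(toy₃ F hw hw0).sA.d42`, and

* `toy₃_N42_side_host` / `toy₃_N42_sideB_host` — `N42_side_host₃` / `N42_sideB_host₃` fire on the toy
  carrier with the two landed toy displays (`toyTypeII_minguez`, `toyTower_ganIchino`);
* **`exists_joint₃_host`** — for every face setting `F`, some period datum and some v3 carrier satisfy
  the SEVEN binders of `periodInputN_of_mains₃` (`N2ToyJoint3.exists_joint₃`, same witness, same proof)
  AND both sides' N4.2 conclusion through the host form, simultaneously: the mains-level binder set and
  the host-form N4.2 obligation are jointly satisfiable on one carrier, with no hypothesis.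

Nothing here is consumed by any theorem of record; no display, no print (the displays enter only through
the landed toy facts of `T6N42Toy.lean`); no object of the host is constructed (the C8 caveat is
unchanged — the toy is a witness of joint satisfiability, not the instance). Proof lane (`rfl` theorems
and one existential, its proof the one of `N2ToyJoint3.toy_periodInputN_of_mains₃`).
README §8(d): uses an L-value-free non-vanishing device: NO (TIER5 §N4.2 / §B, pre-02:16Z lines of
record, continued).

Filed in Tier-6 WAVE 1 as p438968 (proposed 2026-08-26T10:46:37Z, ACCEPTED, commit e79b862585ba);
this v2 differs from the filed bytes in this module docstring only (the staged-record wording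
dropped; every declaration byte-identical to v1).
-/

namespace Summit.Ventures.HodgeRepro2.T6.N42Flath

open scoped InnerProductSpace
open Summit.Ventures.HodgeRepro2
open Summit.Ventures.HodgeRepro2.T6.N42Defs
open Summit.Ventures.HodgeRepro2.T6.N42Datum
open Summit.Ventures.HodgeRepro2.T6.N42Toy
open Summit.Ventures.HodgeRepro2.T6.N2ToyJoint3
open Summit.Ventures.HodgeRepro2.T6.NAutToyN

variable {K : Type} [Field K] [NumberField K] [NumberField.IsCMField K]

/-- Side A of the v3 toy carrier carries the toy finite-places datum (`rfl`). -/
theorem toy₃_sA_d42 (F : FaceSetting K) {σ : K →+* ℂ} {w : KC K} (hw : w ∈ eigenLineK K σ)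
    (hw0 : w ≠ 0) : (toy₃ F hw hw0).sA.d42 = toyFinitePlaces := rfl

/-- Side B of the v3 toy carrier carries the toy finite-places datum (`rfl`). -/
theorem toy₃_sB_d42 (F : FaceSetting K) {σ : K →+* ℂ} {w : KC K} (hw : w ∈ eigenLineK K σ)
    (hw0 : w ≠ 0) : (toy₃ F hw hw0).sB.d42 = toyFinitePlaces := rfl

/-- THE HOST-FORM N4.2 BLOCK ON THE v3 TOY CARRIER, side A: `N42_side_host₃` with the toy first-lift
side, the toy host readings and the two landed toy displays. -/
theorem toy₃_N42_side_host (F : FaceSetting K) {σ : K →+* ℂ} {w : KC K} (hw : w ∈ eigenLineK K σ)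
    (hw0 : w ≠ 0) : (toy₃ F hw hw0).sA.d42.ThetaNonzeroEverywhere :=
  N42Rich.N42_side_host₃ (toy₃ F hw hw0) toyFirstLiftSide toyFirstLiftSide_isLift toyHostReadings
    toyHostReadings_isReading (fun _ => toyTypeII_minguez) (fun _ => toyTower_ganIchino)

/-- The same on side B. -/
theorem toy₃_N42_sideB_host (F : FaceSetting K) {σ : K →+* ℂ} {w : KC K} (hw : w ∈ eigenLineK K σ)
    (hw0 : w ≠ 0) : (toy₃ F hw hw0).sB.d42.ThetaNonzeroEverywhere :=
  N42Rich.N42_sideB_host₃ (toy₃ F hw hw0) toyFirstLiftSide toyFirstLiftSide_isLift toyHostReadings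
    toyHostReadings_isReading (fun _ => toyTypeII_minguez) (fun _ => toyTower_ganIchino)

/-- **JOINT CONSISTENCY OF THE MAINS-LEVEL BINDERS WITH THE HOST-FORM N4.2 BLOCK, NO HYPOTHESIS**: for
every face setting `F` some period datum and some v3 carrier satisfy the seven binders of
`periodInputN_of_mains₃` (exactly as `N2ToyJoint3.exists_joint₃`) AND both sides' N4.2 conclusion derived
through `N42_side_host₃` / `N42_sideB_host₃` — simultaneously (the witness of `exists_joint₂` / `toy₃`,
the proof of `toy_periodInputN_of_mains₃`). -/
theorem exists_joint₃_host (F : FaceSetting K) :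
    ∃ (P : NDatum F) (M : NAut3 F P),
      (∀ c, P.AdmChoice c → M.pairing c ≠ 0 → P.I P.τ₁ c ≠ 0) ∧ M.AdmDatum ∧
      (M.iA → M.iiA → M.ellA) ∧ (M.iB → M.iiB → M.ellB) ∧
      (M.ellA → M.ellB → ∃ (φa : M.d3.A.Sa) (φb : M.d3.A.Sb) (φc : M.d3.B.Sa) (φd : M.d3.B.Sb),
        M.AdmData (φa, φb, φc, φd) ∧ ⟪M.d3.B.F φc φd, M.d3.A.F φa φb⟫_ℂ ≠ 0) ∧
      (M.iA ∧ M.iB) ∧ M.N5 ∧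
      M.sA.d42.ThetaNonzeroEverywhere ∧ M.sB.d42.ThetaNonzeroEverywhere := by
  obtain ⟨σ, w, hw, hw0⟩ := ToyN.exists_eigenvector_KC K
  refine ⟨toyNDatumN F hw hw0, toy₃ F hw hw0, fun c _ _ => I_ne_zero F hw hw0 c,
    toy₃_admDatum F hw hw0, fun _ _ => N3Toy.toy_N3A, fun _ _ => N3Toy.toy_N3A, ?_,
    ⟨N3Toy.toy_hypI, N3Toy.toy_hypI⟩, N5Toy.toyData_N5, toy₃_N42_side_host F hw hw0,
    toy₃_N42_sideB_host F hw hw0⟩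
  intro _ _
  obtain ⟨c, -, hne⟩ :=
    (NAutToyN.toy F hw hw0).exists_choice_of_pairing_ne_zero N3Toy.toy_N3iso
  exact ⟨((NAutToyN.toy F hw hw0).data c).1, ((NAutToyN.toy F hw hw0).data c).2.1,
    ((NAutToyN.toy F hw hw0).data c).2.2.1, ((NAutToyN.toy F hw hw0).data c).2.2.2,
    toy₃_admData F hw hw0 _, hne⟩

end Summit.Ventures.HodgeRepro2.T6.N42Flath
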